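import Literature.AnabelianGeometry.EtaleTheta.Discharge.Sec5Thm57JunctionGammaDeltaLevelNGalois
import Literature.AnabelianGeometry.EtaleTheta.Discharge.Sec5OfThetaSetting
import Literature.AnabelianGeometry.EtaleTheta.RigidOfSetting
import HarnessLib

/-!
# [EtTh] §5, Theorem 5.7 (C)-display — residual (4) «(K4m) at `b`» AT LEVEL `M` OF THE TOWER OF THE SETTING, read from the K4
# junction book (Thm. 5.6 at the member) through the level-`M` rigidity data (Thm 5.7 proof p.330; Thm 5.6 p.328–329)

Mochizuki, *The étale theta function and its Frobenioid-theoretic manifestations*, Publ. RIMS **45** (2009)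
[cite: MochizukiEtTh2009, Thm 5.7 proof p.330 (PDF p.104); Thm 5.6 p.328–329 (PDF pp.102–103); Cor 2.18 (i) p.286 (PDF p.60); §5 p.327 (PDF p.101)].
abc-iut cell, layer L2, node `EtTh:Thm5.7`; seat abc-iut-f-123 (gen 9), abc-iut-L2-lead R1311 «THM57-RESIDUAL-(3)», FILE 2 of the sizing
(STATUS 2026-08-27T07:23:07Z); companion of `Sec5Thm57GammaMuDescentLaws.lean` (FILE 1).  PROOF-ONLY (0 definitions, 0 instances, 0 notation,
no new named fact; nothing landed is edited or restated).

WHAT (abc-iut-L2-d4 g8 memo `MEMO-Thm57-K4m-currency-L2d4g8.md` 41b66533dfb4937a, findings (F1)/(F2), made kernel facts).  The Thm. 5.7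
(C)-displays of record (p486421/p506863 `…_of_mlf_of_kernel[_of_hsepPow]`, p509212 `…_hK4famE′`) carry per family member the clause
(K4m) «`Ψ^Aut_b (m_M⁻¹ x) = m_M⁻¹ (γ_μ,M x)` on `μ_M(B_M)`» at the level `T.atLevel M` of the tower OF THE SETTING
`T = ofThetaSettingFamily τ hC hS h Q R K' …` — whose `(l·Δ_Θ)_(−)`-stub `Q` is ONE level-free datum — while the K4 junction head of record,
abc-iut-w5-d051's `ThetaFrobenioid.psiAut_symm_eq_phiLambda_levelStub_of_pins_galois` (p487842), concludes (K4m) for the §5 datum built on the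
LEVEL-`M` stub `RD_M.levelStub` of the level-`M` rigidity data.  Here `RD_M := C.rigidData (τ.mod M) hC hS h15 L` (abc-iut-L2-t8), whose
`toThetaEnvData` IS the tower's level `(C.thetaEnvTower τ hC hS).level M` (`rfl`), and:
* `atLevel_muTorsion_eq_levelStub` / `atLevel_psiAut_eq_levelStub` / `rho_eq_rhoOfBiKummerData_levelStub` — the STUB-FREE fields agree
  definitionally (`rfl`): `μ_M(B_M)`, `Ψ^Aut_b`, `ρ_M` of `T.atLevel M` are those of
  `𝔉_M := ofConnectedTemperoidData (T := RD_M.toThetaEnvData) h (RD_M.levelStub id) l (R M) id …` (memo (F1), the item it lists as «not checked on the farm»);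
* `psiAut_symm_eq_gammaMu_atLevel_of_pins_galois` — **(K4m) at `b` AT LEVEL `M` OF THE TOWER OF THE SETTING** from p487842's inputs at `𝔉_M`
  VERBATIM (the two pins `hPpre`/`hPproj_pin`, `hH`, `Facts`, the Prop. 5.2 (iii) pin of `η_M`, the Kummer-determined rigidity family
  `(ρ, hB, hKD)`, the Thm. 5.6 Δ-transport `(aΨ, θ′, hΔ)` with (K4β), the level-`M` descent `(φQ, hq, hιN)` of the tower's `γ` with
  `φΛ := γ_μ,M`, Cor. 2.18 (i) `h218i`, and the shadow law `hshadow` of `θ′` against `γ` = the display's residual (3) for `θ′`), by `exact`.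
So residual (4) of the (C)-display is, level by level, THE K4 JUNCTION BOOK BY NAME plus residual (3) (memo (F3)); with FILE 1 the display's
`γ_μ` is the family INDUCED by `γ`, i.e. p487842's `φΛ`.
HONEST FRAMING: a kernel-checked instantiation/transfer between the cell's own typed §5 data; none of the displayed inputs (pins, `hB`,
`hΔ`, (K4β), `hshadow`, F-0620) is asserted to be inhabited at an actual curve (GAP G-w4d042g3-1 stands); [EtTh] is refereed; typed ≠
discharged — PROVED modulo the displayed binders; no side taken on [IUTchIII] Cor. 3.12; nothing here asserts abc proved or refuted.
-/

noncomputable section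

namespace Literature.AnabelianGeometry.EtaleTheta

open CategoryTheory Opposite FrobenioidCyclotomicRigidity Literature.AlgebraicGeometry.Frobenioids Literature.AnabelianGeometry.SemiGraphs
  Literature.AnabelianGeometry.SemiGraphs.GaloisObjects
open Literature.AlgebraicGeometry.Frobenioids.QuasiTemperoid (stabilizerSubgroup)

universe v₀

namespace ThetaFrobenioidTower

variable {p : ℕ} [Fact p.Prime] {D : ThetaSetting p} {E : D.EtaleThetaData} {l : ℕ} {C : E.DoubleUnderline l}
  {e : D.toTemperedCurve.GroupLevelData} {Es : Set ℕ+} (τ : D.CyclotomeTower l Es) (hC : D.Compat) (hS : D.Sec2Hyps)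
  {D₀ : Type} [Category.{v₀} D₀] {V : FrdIMonoidStub.{0}} {T₀ : RealifiedDivisorMonoids (D₀ := D₀) V}
  {VD : FrdICatStub.{1, 0, 0} (ConnectedPart (BTemp (C.temperedArithmeticGroup e).Pi))}
  {tf : TemperedFrobenioid T₀ (ConnectedPart (BTemp (C.temperedArithmeticGroup e).Pi)) VD} {hZ : tf.monoidType = MonoidType.Z}
  {hP : ∀ A : (ConnectedPart (BTemp (C.temperedArithmeticGroup e).Pi))ᵒᵖ, IsPerfect (tf.Φ.carrier A)}
  {NH : Subgroup (Field.absoluteGaloisGroup D.K) → tf.category → ℕ+ → Prop} {A₀ : tf.category}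
  {hA₀ : PreFrobenioid.IsFrobeniusTrivial tf.toElem A₀} {hA₀' : SemiGraphs.IsGaloisObj A₀.base.obj}
  {pullFrac : ∀ {A A' : (BiKummerSetting.mkOfConnectedTemperoid (C.temperedArithmeticGroup e) tf hZ hP NH A₀ hA₀ hA₀').C} (_ : A' ⟶ A),
    (BiKummerSetting.mkOfConnectedTemperoid (C.temperedArithmeticGroup e) tf hZ hP NH A₀ hA₀ hA₀').biratUnits A →
      (BiKummerSetting.mkOfConnectedTemperoid (C.temperedArithmeticGroup e) tf hZ hP NH A₀ hA₀ hA₀').biratUnits A'}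
  {θ : (BiKummerSetting.mkOfConnectedTemperoid (C.temperedArithmeticGroup e) tf hZ hP NH A₀ hA₀ hA₀').biratUnits
    (BiKummerSetting.mkOfConnectedTemperoid (C.temperedArithmeticGroup e) tf hZ hP NH A₀ hA₀ hA₀').Aodot}
  {Bl : (BiKummerSetting.mkOfConnectedTemperoid (C.temperedArithmeticGroup e) tf hZ hP NH A₀ hA₀ hA₀').C}
  {Pl : (BiKummerSetting.mkOfConnectedTemperoid (C.temperedArithmeticGroup e) tf hZ hP NH A₀ hA₀ hA₀').FractionPair θ Bl}
  {Rl : (BiKummerSetting.mkOfConnectedTemperoid (C.temperedArithmeticGroup e) tf hZ hP NH A₀ hA₀ hA₀').NthRoot θ Pl C.lPNat pullFrac}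
  (h : ModelFrobenioid.Hypotheses tf.divisorMonoid tf.ratFnFunctor)
  (Q : FrobenioidTheta.ThetaSubquotientStub.{0} (ConnectedPart (BTemp (C.temperedArithmeticGroup e).Pi)))
  (R : ∀ N : ℕ+, (BiKummerSetting.mkOfConnectedTemperoid (C.temperedArithmeticGroup e) tf hZ hP NH A₀ hA₀ hA₀').NthRoot Rl.root Rl.pair N pullFrac)
  (K' : Type) [Field K'] (constEmb : ∀ N : ℕ+, K'ˣ →* tf.biratUnitsModel (R N).BN)
  (constEmb_injective : ∀ N : ℕ+, Function.Injective (constEmb N))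
  (hinvc : ∀ (N : ℕ+) (g : Aut (R N).AN.base),
    pull tf.divisorMonoid g.hom (ModelFrobenioid.div (R N).pair.num) = ModelFrobenioid.div (R N).pair.num)
  (hinvp : ∀ (N : ℕ+) (y : (C.thetaEnvTower τ hC hS).PiX), y ∈ (C.thetaEnvTower τ hC hS).PiYdd →
    pull tf.divisorMonoid ((BiKummerSetting.mkOfConnectedTemperoid (C.temperedArithmeticGroup e) tf hZ hP NH A₀ hA₀ hA₀').galoisSurj
      (R N).AN.base (R N).αData.isGalois ((ContinuousMulEquiv.refl _) y)).hom (ModelFrobenioid.div (R N).pair.den) =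
        ModelFrobenioid.div (R N).pair.den)
  (α : ∀ {N N' : ℕ+}, (N : ℕ) ∣ N' → ((R N').AN ⟶ (R N).AN))
  (β : ∀ {N N' : ℕ+}, (N : ℕ) ∣ N' → ((R N').BN ⟶ (R N).BN))
  (comm_sCap : ∀ {N N' : ℕ+} (hd : (N : ℕ) ∣ N'), (R N').pair.num ≫ β hd = α hd ≫ (R N).pair.num)
  (comm_sCup : ∀ {N N' : ℕ+} (hd : (N : ℕ) ∣ N'), (R N').pair.den ≫ β hd = α hd ≫ (R N).pair.den)
  (isIsometry_α : ∀ {N N' : ℕ+} (hd : (N : ℕ) ∣ N'),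
    ((BiKummerSetting.mkOfConnectedTemperoid (C.temperedArithmeticGroup e) tf hZ hP NH A₀ hA₀ hA₀').sec5Stub h).pre.IsIsometry (α hd))
  (degFr_α : ∀ {N N' : ℕ+} (hd : (N : ℕ) ∣ N'),
    (((BiKummerSetting.mkOfConnectedTemperoid (C.temperedArithmeticGroup e) tf hZ hP NH A₀ hA₀ hA₀').sec5Stub h).pre.degFr (α hd) : ℕ) *
      N = N')
  (isIsometry_β : ∀ {N N' : ℕ+} (hd : (N : ℕ) ∣ N'),
    ((BiKummerSetting.mkOfConnectedTemperoid (C.temperedArithmeticGroup e) tf hZ hP NH A₀ hA₀ hA₀').sec5Stub h).pre.IsIsometry (β hd))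
  (degFr_β : ∀ {N N' : ℕ+} (hd : (N : ℕ) ∣ N'),
    (((BiKummerSetting.mkOfConnectedTemperoid (C.temperedArithmeticGroup e) tf hZ hP NH A₀ hA₀ hA₀').sec5Stub h).pre.degFr (β hd) : ℕ) *
      N = N')
  (baseFrob_α : ∀ {N N' : ℕ+} (hd : (N : ℕ) ∣ N'),
    (BiKummerSetting.mkOfConnectedTemperoid (C.temperedArithmeticGroup e) tf hZ hP NH A₀ hA₀ hA₀').IsOfBaseFrobeniusType (α hd))
  (h15 : ThetaSetting.Prop15iii E hC) (L : C.CuspLabels) (M : Es)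


/-- **(F1) `μ_M(B_M)` is stub-free**: the `N`-torsion of `O^×(B_M)` at level `M` of the tower of the Setting IS that of the §5 datum on the
level-`M` rigidity-data stub (definitionally). [cite: MochizukiEtTh2009, Def 5.4 p.327 (PDF p.101)] -/
theorem atLevel_muTorsion_eq_levelStub :
    ((ofThetaSettingFamily τ hC hS h Q R K' constEmb constEmb_injective hinvc hinvp α β comm_sCap comm_sCup isIsometry_α degFr_α
        isIsometry_β degFr_β baseFrob_α).atLevel M).muTorsion
      ((ofThetaSettingFamily τ hC hS h Q R K' constEmb constEmb_injective hinvc hinvp α β comm_sCap comm_sCup isIsometry_α degFr_α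
        isIsometry_β degFr_β baseFrob_α).atLevel M).BN
      ((ofThetaSettingFamily τ hC hS h Q R K' constEmb constEmb_injective hinvc hinvp α β comm_sCap comm_sCup isIsometry_α degFr_α
        isIsometry_β degFr_β baseFrob_α).atLevel M).N =
    (ThetaFrobenioid.ofConnectedTemperoidData (T := (C.rigidData (τ.mod M) hC hS h15 L).toThetaEnvData) h
        ((C.rigidData (τ.mod M) hC hS h15 L).levelStub (ContinuousMulEquiv.refl (C.temperedArithmeticGroup e).Pi)) C.odd_lPNat (R M)
        (ContinuousMulEquiv.refl (C.temperedArithmeticGroup e).Pi) K' (constEmb M) (constEmb_injective M) (hinvc M) (hinvp M)).muTorsion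
      (ThetaFrobenioid.ofConnectedTemperoidData (T := (C.rigidData (τ.mod M) hC hS h15 L).toThetaEnvData) h
        ((C.rigidData (τ.mod M) hC hS h15 L).levelStub (ContinuousMulEquiv.refl (C.temperedArithmeticGroup e).Pi)) C.odd_lPNat (R M)
        (ContinuousMulEquiv.refl (C.temperedArithmeticGroup e).Pi) K' (constEmb M) (constEmb_injective M) (hinvc M) (hinvp M)).BN
      (ThetaFrobenioid.ofConnectedTemperoidData (T := (C.rigidData (τ.mod M) hC hS h15 L).toThetaEnvData) h
        ((C.rigidData (τ.mod M) hC hS h15 L).levelStub (ContinuousMulEquiv.refl (C.temperedArithmeticGroup e).Pi)) C.odd_lPNat (R M)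
        (ContinuousMulEquiv.refl (C.temperedArithmeticGroup e).Pi) K' (constEmb M) (constEmb_injective M) (hinvc M) (hinvp M)).N := rfl

/-- **(F1) `Ψ^Aut_b` is stub-free**: "the automorphism determined by applying `Ψ` followed by conjugation by `β`" (Thm. 5.10 (ii)) at level `M`
of the tower of the Setting IS that of the §5 datum on the level-`M` stub (definitionally). [cite: MochizukiEtTh2009, Thm 5.10 (ii) p.333 (PDF p.107)] -/
theorem atLevel_psiAut_eq_levelStub
    (Ψ : (BiKummerSetting.mkOfConnectedTemperoid (C.temperedArithmeticGroup e) tf hZ hP NH A₀ hA₀ hA₀').C ≌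
      (BiKummerSetting.mkOfConnectedTemperoid (C.temperedArithmeticGroup e) tf hZ hP NH A₀ hA₀ hA₀').C)
    (b : Ψ.functor.obj (R M).BN ≅ (R M).BN) (u : Aut (R M).BN) :
    ((ofThetaSettingFamily τ hC hS h Q R K' constEmb constEmb_injective hinvc hinvp α β comm_sCap comm_sCup isIsometry_α degFr_α
        isIsometry_β degFr_β baseFrob_α).atLevel M).psiAut Ψ b u =
    (ThetaFrobenioid.ofConnectedTemperoidData (T := (C.rigidData (τ.mod M) hC hS h15 L).toThetaEnvData) h
        ((C.rigidData (τ.mod M) hC hS h15 L).levelStub (ContinuousMulEquiv.refl (C.temperedArithmeticGroup e).Pi)) C.odd_lPNat (R M)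
        (ContinuousMulEquiv.refl (C.temperedArithmeticGroup e).Pi) K' (constEmb M) (constEmb_injective M) (hinvc M) (hinvp M)).psiAut Ψ b u := rfl

/-- **`ρ_M` of the tower of the Setting is `rhoOfBiKummerData (R M) id` over the level-`M` rigidity data** (definitionally) — so p487842's
shadow law `hshadow` reads on the tower's `ρ_M`. [cite: MochizukiEtTh2009, §5 p.331 (PDF p.105)] -/
theorem rho_eq_rhoOfBiKummerData_levelStub (k : (C.thetaEnvTower τ hC hS).PiX) :
    (ofThetaSettingFamily τ hC hS h Q R K' constEmb constEmb_injective hinvc hinvp α β comm_sCap comm_sCup isIsometry_α degFr_α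
        isIsometry_β degFr_β baseFrob_α).ρ M k =
      ThetaFrobenioid.rhoOfBiKummerData (T := (C.rigidData (τ.mod M) hC hS h15 L).toThetaEnvData) (R M)
        (ContinuousMulEquiv.refl (C.temperedArithmeticGroup e).Pi) k := rfl

/-- **Residual (4) «(K4m) at `b`» AT LEVEL `M` OF THE TOWER OF THE SETTING, from the K4 junction book** — abc-iut-w5-d051's
`psiAut_symm_eq_phiLambda_levelStub_of_pins_galois` (p487842) at the level-`M` rigidity data `RD_M := C.rigidData (τ.mod M) hC hS h15 L`, its
inputs VERBATIM (read at `𝔉_M := ofConnectedTemperoidData (T := RD_M.toThetaEnvData) h (RD_M.levelStub id) l (R M) id …`), `φ := γ`, `φΛ := γ_μ,M`, conclusion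
transferred to `T.atLevel M` by the stub-free identities above: for every `x ∈ μ_M`, `Ψ^Aut_b (m⁻¹ x) = m⁻¹ (γ_μ,M x)`.
[cite: MochizukiEtTh2009, Thm 5.7 proof p.330 (PDF p.104); Thm 5.6 p.328 (PDF p.102)] -/
theorem psiAut_symm_eq_gammaMu_atLevel_of_pins_galois [(C.rigidData (τ.mod M) hC hS h15 L).iotaN.range.Normal]
    {Gal : ConnectedPart (BTemp (C.temperedArithmeticGroup e).Pi) → Prop}
    (P : ThetaSubquotientProjGalois (ThetaFrobenioid.ofConnectedTemperoidData (T := (C.rigidData (τ.mod M) hC hS h15 L).toThetaEnvData) h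
        ((C.rigidData (τ.mod M) hC hS h15 L).levelStub (ContinuousMulEquiv.refl (C.temperedArithmeticGroup e).Pi)) C.odd_lPNat (R M)
        (ContinuousMulEquiv.refl (C.temperedArithmeticGroup e).Pi) K' (constEmb M) (constEmb_injective M) (hinvc M) (hinvp M)) Gal)
    (hPpre : P.pre (R M).BN.base =
      (ThetaSubquotient.autPre ((C.rigidData (τ.mod M) hC hS h15 L).qN (ContinuousMulEquiv.refl (C.temperedArithmeticGroup e).Pi)) (C.rigidData (τ.mod M) hC hS h15 L).iotaN (R M).BN.base.obj).comap
        (Functor.mapAut (R M).BN.base (connectedObjects (BTemp (C.temperedArithmeticGroup e).Pi)).ι))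
    (hPproj_pin : ∀ (σ : P.pre (R M).BN.base)
      (t : ThetaSubquotient.autPre ((C.rigidData (τ.mod M) hC hS h15 L).qN (ContinuousMulEquiv.refl (C.temperedArithmeticGroup e).Pi)) (C.rigidData (τ.mod M) hC hS h15 L).iotaN (R M).BN.base.obj),
      Functor.mapAut (R M).BN.base (connectedObjects (BTemp (C.temperedArithmeticGroup e).Pi)).ι (σ : Aut (R M).BN.base) =
          (t : Aut (R M).BN.base.obj) →
        (P.proj (R M).BN.base σ : ThetaSubquotient.LDelta ((C.rigidData (τ.mod M) hC hS h15 L).qN (ContinuousMulEquiv.refl (C.temperedArithmeticGroup e).Pi)) (C.rigidData (τ.mod M) hC hS h15 L).iotaN (R M).BN.base.obj) =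
          ThetaSubquotient.autProj ((C.rigidData (τ.mod M) hC hS h15 L).qN (ContinuousMulEquiv.refl (C.temperedArithmeticGroup e).Pi)) (C.rigidData (τ.mod M) hC hS h15 L).iotaN (R M).BN.base.obj t)
    (hH : (stabilizerSubgroup (R M).BN.base.obj ((BiKummerSetting.NthRoot.baseIso _ (R M)).hom.hom.hom.hom
        (galoisBase (C.temperedArithmeticGroup e).isTempered (R M).AN.base.obj (R M).αData.isGalois))).comap
          (ContinuousMulEquiv.refl (C.temperedArithmeticGroup e).Pi).toMonoidHom ≤ (C.thetaEnvTower τ hC hS).PiYdd)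
    (HF : (ThetaFrobenioid.ofConnectedTemperoidData (T := (C.rigidData (τ.mod M) hC hS h15 L).toThetaEnvData) h
        ((C.rigidData (τ.mod M) hC hS h15 L).levelStub (ContinuousMulEquiv.refl (C.temperedArithmeticGroup e).Pi)) C.odd_lPNat (R M)
        (ContinuousMulEquiv.refl (C.temperedArithmeticGroup e).Pi) K' (constEmb M) (constEmb_injective M) (hinvc M) (hinvp M)).Facts)
    (m : ((ofThetaSettingFamily τ hC hS h Q R K' constEmb constEmb_injective hinvc hinvp α β comm_sCap comm_sCup isIsometry_α degFr_α
        isIsometry_β degFr_β baseFrob_α).atLevel M).muTorsion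
        ((ofThetaSettingFamily τ hC hS h Q R K' constEmb constEmb_injective hinvc hinvp α β comm_sCap comm_sCup isIsometry_α degFr_α
        isIsometry_β degFr_β baseFrob_α).atLevel M).BN
        ((ofThetaSettingFamily τ hC hS h Q R K' constEmb constEmb_injective hinvc hinvp α β comm_sCap comm_sCup isIsometry_α degFr_α
        isIsometry_β degFr_β baseFrob_α).atLevel M).N ≃* ((C.thetaEnvTower τ hC hS).level M).mu)
    (hι : (ThetaFrobenioid.ofConnectedTemperoidData (T := (C.rigidData (τ.mod M) hC hS h15 L).toThetaEnvData) h
        ((C.rigidData (τ.mod M) hC hS h15 L).levelStub (ContinuousMulEquiv.refl (C.temperedArithmeticGroup e).Pi)) C.odd_lPNat (R M)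
        (ContinuousMulEquiv.refl (C.temperedArithmeticGroup e).Pi) K' (constEmb M) (constEmb_injective M) (hinvc M) (hinvp M)).IdentifiesPiYdd (C.rigidData (τ.mod M) hC hS h15 L).toThetaEnvData (MulEquiv.refl _))
    {η : (C.thetaEnvTower τ hC hS).PiYdd → (C.thetaEnvTower τ hC hS).mu M} (hη : η ∈ (C.thetaEnvTower τ hC hS).thetaCocycles M)
    (hpin : (ThetaFrobenioid.ofConnectedTemperoidData (T := (C.rigidData (τ.mod M) hC hS h15 L).toThetaEnvData) h
        ((C.rigidData (τ.mod M) hC hS h15 L).levelStub (ContinuousMulEquiv.refl (C.temperedArithmeticGroup e).Pi)) C.odd_lPNat (R M)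
        (ContinuousMulEquiv.refl (C.temperedArithmeticGroup e).Pi) K' (constEmb M) (constEmb_injective M) (hinvc M) (hinvp M)).ThetaSectionCompat HF (C.rigidData (τ.mod M) hC hS h15 L).toThetaEnvData (MulEquiv.refl _) m hι η)
    {ρ : RigidityFamily (ThetaFrobenioid.ofConnectedTemperoidData (T := (C.rigidData (τ.mod M) hC hS h15 L).toThetaEnvData) h
        ((C.rigidData (τ.mod M) hC hS h15 L).levelStub (ContinuousMulEquiv.refl (C.temperedArithmeticGroup e).Pi)) C.odd_lPNat (R M)
        (ContinuousMulEquiv.refl (C.temperedArithmeticGroup e).Pi) K' (constEmb M) (constEmb_injective M) (hinvc M) (hinvp M))}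
    {hB : (ThetaFrobenioid.ofConnectedTemperoidData (T := (C.rigidData (τ.mod M) hC hS h15 L).toThetaEnvData) h
        ((C.rigidData (τ.mod M) hC hS h15 L).levelStub (ContinuousMulEquiv.refl (C.temperedArithmeticGroup e).Pi)) C.odd_lPNat (R M)
        (ContinuousMulEquiv.refl (C.temperedArithmeticGroup e).Pi) K' (constEmb M) (constEmb_injective M) (hinvc M) (hinvp M)).IsThetaSaturated (R M).BN}
    (hKD : P.IsKummerDetermined ρ hB)
    (Ψ : (BiKummerSetting.mkOfConnectedTemperoid (C.temperedArithmeticGroup e) tf hZ hP NH A₀ hA₀ hA₀').C ≌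
      (BiKummerSetting.mkOfConnectedTemperoid (C.temperedArithmeticGroup e) tf hZ hP NH A₀ hA₀ hA₀').C)
    (b : Ψ.functor.obj (R M).BN ≅ (R M).BN)
    (aΨ : ∀ S, (ThetaFrobenioid.ofConnectedTemperoidData (T := (C.rigidData (τ.mod M) hC hS h15 L).toThetaEnvData) h
        ((C.rigidData (τ.mod M) hC hS h15 L).levelStub (ContinuousMulEquiv.refl (C.temperedArithmeticGroup e).Pi)) C.odd_lPNat (R M)
        (ContinuousMulEquiv.refl (C.temperedArithmeticGroup e).Pi) K' (constEmb M) (constEmb_injective M) (hinvc M) (hinvp M)).lDeltaModN S ≃* (ThetaFrobenioid.ofConnectedTemperoidData (T := (C.rigidData (τ.mod M) hC hS h15 L).toThetaEnvData) h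
        ((C.rigidData (τ.mod M) hC hS h15 L).levelStub (ContinuousMulEquiv.refl (C.temperedArithmeticGroup e).Pi)) C.odd_lPNat (R M)
        (ContinuousMulEquiv.refl (C.temperedArithmeticGroup e).Pi) K' (constEmb M) (constEmb_injective M) (hinvc M) (hinvp M)).lDeltaModN (Ψ.functor.obj S))
    (θ' : Aut (R M).BN.base ≃* Aut (R M).BN.base)
    (hΔ : ThetaFrobenioid.Thm56Sub.DeltaTransportCompatGal (ThetaFrobenioid.ofConnectedTemperoidData (T := (C.rigidData (τ.mod M) hC hS h15 L).toThetaEnvData) h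
        ((C.rigidData (τ.mod M) hC hS h15 L).levelStub (ContinuousMulEquiv.refl (C.temperedArithmeticGroup e).Pi)) C.odd_lPNat (R M)
        (ContinuousMulEquiv.refl (C.temperedArithmeticGroup e).Pi) K' (constEmb M) (constEmb_injective M) (hinvc M) (hinvp M)) Ψ b aΨ θ' P)
    (γ : (C.thetaEnvTower τ hC hS).PiX ≃ₜ* (C.thetaEnvTower τ hC hS).PiX)
    (φQ : (C.rigidData (τ.mod M) hC hS h15 L).LevelQuot ≃* (C.rigidData (τ.mod M) hC hS h15 L).LevelQuot) (γμ : (C.thetaEnvTower τ hC hS).mu M ≃* (C.thetaEnvTower τ hC hS).mu M)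
    (hq : ∀ g : (C.thetaEnvTower τ hC hS).PiX, (C.rigidData (τ.mod M) hC hS h15 L).qN (ContinuousMulEquiv.refl (C.temperedArithmeticGroup e).Pi) (γ g) = φQ ((C.rigidData (τ.mod M) hC hS h15 L).qN (ContinuousMulEquiv.refl (C.temperedArithmeticGroup e).Pi) g))
    (hιN : ∀ a : (C.thetaEnvTower τ hC hS).mu M, (C.rigidData (τ.mod M) hC hS h15 L).iotaN (γμ a) = φQ ((C.rigidData (τ.mod M) hC hS h15 L).iotaN a))
    (h218i : (C.rigidData (τ.mod M) hC hS h15 L).Cor218_i)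
    (hshadow : ∀ k : (C.thetaEnvTower τ hC hS).PiYdd,
      θ' ((ofThetaSettingFamily τ hC hS h Q R K' constEmb constEmb_injective hinvc hinvp α β comm_sCap comm_sCup isIsometry_α degFr_α
        isIsometry_β degFr_β baseFrob_α).ρ M (k : (C.thetaEnvTower τ hC hS).PiX)) =
        (ofThetaSettingFamily τ hC hS h Q R K' constEmb constEmb_injective hinvc hinvp α β comm_sCap comm_sCup isIsometry_α degFr_α
        isIsometry_β degFr_β baseFrob_α).ρ M (γ (k : (C.thetaEnvTower τ hC hS).PiX)))
    (hK4β : ∀ y, (ThetaFrobenioid.ofConnectedTemperoidData (T := (C.rigidData (τ.mod M) hC hS h15 L).toThetaEnvData) h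
        ((C.rigidData (τ.mod M) hC hS h15 L).levelStub (ContinuousMulEquiv.refl (C.temperedArithmeticGroup e).Pi)) C.odd_lPNat (R M)
        (ContinuousMulEquiv.refl (C.temperedArithmeticGroup e).Pi) K' (constEmb M) (constEmb_injective M) (hinvc M) (hinvp M)).psiAut Ψ b (ρ (R M).BN hB y : Aut (R M).BN) =
      (ρ (R M).BN hB ((ThetaFrobenioid.ofConnectedTemperoidData (T := (C.rigidData (τ.mod M) hC hS h15 L).toThetaEnvData) h
        ((C.rigidData (τ.mod M) hC hS h15 L).levelStub (ContinuousMulEquiv.refl (C.temperedArithmeticGroup e).Pi)) C.odd_lPNat (R M)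
        (ContinuousMulEquiv.refl (C.temperedArithmeticGroup e).Pi) K' (constEmb M) (constEmb_injective M) (hinvc M) (hinvp M)).lDeltaModNMap b.hom (aΨ (R M).BN y)) : Aut (R M).BN))
    (x : (C.thetaEnvTower τ hC hS).mu M) :
    ((ofThetaSettingFamily τ hC hS h Q R K' constEmb constEmb_injective hinvc hinvp α β comm_sCap comm_sCup isIsometry_α degFr_α
        isIsometry_β degFr_β baseFrob_α).atLevel M).psiAut Ψ b
        ((m.symm x : ((ofThetaSettingFamily τ hC hS h Q R K' constEmb constEmb_injective hinvc hinvp α β comm_sCap comm_sCup isIsometry_α degFr_α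
        isIsometry_β degFr_β baseFrob_α).atLevel M).muTorsion
          ((ofThetaSettingFamily τ hC hS h Q R K' constEmb constEmb_injective hinvc hinvp α β comm_sCap comm_sCup isIsometry_α degFr_α
        isIsometry_β degFr_β baseFrob_α).atLevel M).BN
          ((ofThetaSettingFamily τ hC hS h Q R K' constEmb constEmb_injective hinvc hinvp α β comm_sCap comm_sCup isIsometry_α degFr_α
        isIsometry_β degFr_β baseFrob_α).atLevel M).N) : Aut ((ofThetaSettingFamily τ hC hS h Q R K' constEmb constEmb_injective hinvc hinvp α β comm_sCap comm_sCup isIsometry_α degFr_α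
        isIsometry_β degFr_β baseFrob_α).atLevel M).BN) =
      ((m.symm (γμ x) : ((ofThetaSettingFamily τ hC hS h Q R K' constEmb constEmb_injective hinvc hinvp α β comm_sCap comm_sCup isIsometry_α degFr_α
        isIsometry_β degFr_β baseFrob_α).atLevel M).muTorsion
          ((ofThetaSettingFamily τ hC hS h Q R K' constEmb constEmb_injective hinvc hinvp α β comm_sCap comm_sCup isIsometry_α degFr_α
        isIsometry_β degFr_β baseFrob_α).atLevel M).BN
          ((ofThetaSettingFamily τ hC hS h Q R K' constEmb constEmb_injective hinvc hinvp α β comm_sCap comm_sCup isIsometry_α degFr_α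
        isIsometry_β degFr_β baseFrob_α).atLevel M).N) : Aut ((ofThetaSettingFamily τ hC hS h Q R K' constEmb constEmb_injective hinvc hinvp α β comm_sCap comm_sCup isIsometry_α degFr_α
        isIsometry_β degFr_β baseFrob_α).atLevel M).BN) := by
  exact ThetaFrobenioid.psiAut_symm_eq_phiLambda_levelStub_of_pins_galois (RD := (C.rigidData (τ.mod M) hC hS h15 L)) h C.odd_lPNat (R M)
    (ContinuousMulEquiv.refl (C.temperedArithmeticGroup e).Pi) K' (constEmb M) (constEmb_injective M) (hinvc M) (hinvp M) P hPpre hPproj_pin hH HF m hι hη hpin hKD Ψ b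
    aΨ θ' hΔ γ φQ γμ hq hιN h218i hshadow hK4β x

end ThetaFrobenioidTower

end Literature.AnabelianGeometry.EtaleTheta

end
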